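import Summits.MatrixMultiplication.MatrixMultiplication.Theorems.LevelGradedCohnUmansTokenBudget
import Literature.RepresentationTheory.FiniteGroups.WordIsotypicDominance

/-!
# Schur–Weyl pricing of the colour cell (stub `stub_colourPricing` of line
# `schur-weyl-colour-cells`, crux `LevelGradedCohnUmans.GradedDesignFamily`)

For `n r : ℕ` let `J_r(n) ≤ ℂ^{𝔖ₙ}` be the **colour cell**: the span of the colouring-incidence
tests `g ↦ [c' ∘ g = c]` of pairs of `r`-colourings `c, c' : [n] → [r]` (the coefficient space of
the Schur–Weyl module `(ℂ^r)^{⊗n}`).  We prove, for every real `s`,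

  `∑ᶠ_{χ ∈ Irr(𝔖ₙ) ∩ J_r(n)} (χ 1).re ^ s ≤ ∑_{μ ⊢ n, ℓ(μ) ≤ r} (f^μ) ^ s`,

`f^μ = numStandardTableaux μ`: every irreducible character of `𝔖ₙ` lying in `J_r(n)` is a
Specht character `χ^μ` with at most `r` rows (Young's rule for the permutation module on
`r`-colourings, pricing direction), distinct characters have distinct `μ`, `χ^μ(1) = f^μ`, and
the unused terms are `≥ 0`.  This is the `r`-row twin of the landed `tokenBudget_proof`
(`Theorems/LevelGradedCohnUmansTokenBudget.lean`) and follows it step by step; the only new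
ingredient is that the class sum of a colour test is a translate of a Young-subgroup
(word-stabiliser) sum instead of a pointwise-stabiliser sum:

* the class sum `T_{c,c'} = ∑_{σ : c' ∘ σ = c} σ` is `0` (empty class) or `a_{c'} · π` for any
  `π` with `c' ∘ π = c`, where `a_w = ∑_{σ ∈ Stab(w)} σ` (`stabSymmetrizer`,
  `Literature/RepresentationTheory/FiniteGroups/WordIsotypicDominance.lean`);
* if `r < ℓ(μ)` then for every `g` the `r`-colouring `c' ∘ g` repeats a letter at two positions
  of the first column of the canonical tableau of `μ` (pigeonhole, `exists_ne_colOf_eq_apply_eq`),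
  so `a_{c'} · z · b_μ = 0` for all `z` (`stabSymmetrizer_mul_mul_colAntisymmetrizer_eq_zero`,
  Fulton–Harris Lemma 4.23 (1)), hence `T_{c,c'}` kills `S^μ = ℂ[𝔖ₙ] a_μ b_μ` and the Fourier
  transform of every `f ∈ J_r(n)` vanishes at `[μ]` (`Submodule.span_induction`);
* the Fourier transform of `χ^μ` at `[μ]` is nonzero (`fourierSpecht_spechtCharacter_self_ne_zero`),
  so `χ^μ ∈ J_r(n) ⇒ ℓ(μ) ≤ r`; finish as in `tokenBudget_proof`.

Supports item `stmt-MatrixMultiplication-7610`; theorems only, no definitions.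
-/

-- `Summit.<Summit>.<Problem>` is the tree's mandated summit-side namespace; for this
-- single-conjunct summit the two coincide, so the file silences `dupNamespace`.
set_option linter.dupNamespace false

noncomputable section

open scoped BigOperators
open Literature.RepresentationTheory.FiniteGroups
open Literature.NumberTheory.DiophantineGeometry

namespace Summit.MatrixMultiplication.MatrixMultiplication.Theorems.GradedDesignFamily

variable {n r : ℕ}

/-- A nonempty colour class is a translate of a word stabiliser:
`T_{c,c'} = ∑_{σ : c' ∘ σ = c} σ = a_{c'} · π` for any `π` with `c' ∘ π = c`
(`a_{c'} = ∑_{σ ∈ Stab(c')} σ`, `Stab(c') = {σ | c' ∘ σ = c'}`). -/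
theorem colourPricing_classSum_eq_stabSymmetrizer_mul_of (c c' : Fin n → Fin r)
    {π : Equiv.Perm (Fin n)} (hπ : c' ∘ ⇑π = c) :
    ∑ σ ∈ Finset.univ.filter (fun σ : Equiv.Perm (Fin n) => c' ∘ ⇑σ = c),
        MonoidAlgebra.of ℂ _ σ =
      stabSymmetrizer c' * MonoidAlgebra.of ℂ _ π := by
  unfold stabSymmetrizer
  rw [Finset.sum_mul]
  symm
  refine Finset.sum_equiv (Equiv.mulRight π) (fun σ => ?_) (fun σ _ => ?_)
  · simp only [Equiv.coe_mulRight, Finset.mem_filter, Finset.mem_univ, true_and, mem_stabFinset,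
      mem_wordStabilizer_iff]
    constructor
    · intro h
      funext q
      rw [Function.comp_apply, Equiv.Perm.mul_apply, h (π q)]
      exact congrFun hπ q
    · intro h p
      have h1 := congrFun h (π⁻¹ p)
      have h2 := congrFun hπ (π⁻¹ p)
      simp only [Function.comp_apply, Equiv.Perm.mul_apply, Equiv.Perm.coe_inv,
        Equiv.apply_symm_apply] at h1 h2
      rw [h1, h2]
  · rw [Equiv.coe_mulRight, map_mul]

/-- **Colour class sums kill the Specht modules `S^μ` with more than `r` rows**: for
`r`-colourings `c c'` and `r < ℓ(μ)`, `T_{c,c'} · z · b_μ = 0` for every `z ∈ ℂ[𝔖ₙ]` (empty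
class, or `T_{c,c'} = a_{c'} π` and, for every `g`, the colouring `c' ∘ g` repeats a letter in
the first column of the canonical tableau of `μ` — pigeonhole — so the transposition trick of
Fulton–Harris Lemma 4.23 (1) applies). -/
theorem colourPricing_classSum_mul_mul_colAntisymmetrizer_eq_zero (c c' : Fin n → Fin r)
    {μ : Nat.Partition n} (hμ : r < Multiset.card μ.parts)
    (z : MonoidAlgebra ℂ (Equiv.Perm (Fin n))) :
    (∑ σ ∈ Finset.univ.filter (fun σ : Equiv.Perm (Fin n) => c' ∘ ⇑σ = c),
        MonoidAlgebra.of ℂ _ σ) * z * colAntisymmetrizer ℂ μ = 0 := by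
  by_cases hT : ∃ π : Equiv.Perm (Fin n), c' ∘ ⇑π = c
  · obtain ⟨π, hπ⟩ := hT
    rw [colourPricing_classSum_eq_stabSymmetrizer_mul_of c c' hπ,
      mul_assoc _ (MonoidAlgebra.of ℂ _ π) z]
    refine stabSymmetrizer_mul_mul_colAntisymmetrizer_eq_zero (fun g => ?_) _
    have hcard : Fintype.card (Fin r) < Multiset.card μ.parts := by rwa [Fintype.card_fin]
    obtain ⟨i, j, hij, hcol, hg⟩ := exists_ne_colOf_eq_apply_eq μ hcard (c' ∘ ⇑g)
    refine ⟨g i, g j, g.injective.ne hij, hg, ?_⟩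
    simpa using hcol
  · have hempty : Finset.univ.filter (fun σ : Equiv.Perm (Fin n) => c' ∘ ⇑σ = c) = ∅ :=
      Finset.filter_eq_empty_iff.2 fun σ _ h => hT ⟨σ, h⟩
    rw [hempty, Finset.sum_empty, zero_mul, zero_mul]

/-- Colour class sums annihilate `S^μ = ℂ[𝔖ₙ] a_μ b_μ` when `r < ℓ(μ)`. -/
theorem colourPricing_classSum_mul_eq_zero_of_mem_spechtIdeal (c c' : Fin n → Fin r)
    {μ : Nat.Partition n} (hμ : r < Multiset.card μ.parts)
    {w : MonoidAlgebra ℂ (Equiv.Perm (Fin n))} (hw : w ∈ spechtIdeal ℂ μ) :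
    (∑ σ ∈ Finset.univ.filter (fun σ : Equiv.Perm (Fin n) => c' ∘ ⇑σ = c),
        MonoidAlgebra.of ℂ _ σ) * w = 0 := by
  obtain ⟨y, rfl⟩ := Ideal.mem_span_singleton'.1 hw
  rw [youngSymmetrizer, ← mul_assoc y, ← mul_assoc]
  exact colourPricing_classSum_mul_mul_colAntisymmetrizer_eq_zero c c' hμ _

/-- The group-algebra element `z_f = ∑_σ f(σ) σ` of the colour test `f = [c' ∘ · = c]` is the
colour class sum `T_{c,c'}`. -/
theorem colourPricing_sum_colourTest_smul_of (c c' : Fin n → Fin r) :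
    ∑ σ : Equiv.Perm (Fin n), (if c' ∘ ⇑σ = c then (1 : ℂ) else 0) • MonoidAlgebra.of ℂ _ σ =
      ∑ σ ∈ Finset.univ.filter (fun σ : Equiv.Perm (Fin n) => c' ∘ ⇑σ = c),
        MonoidAlgebra.of ℂ _ σ := by
  rw [Finset.sum_filter]
  refine Finset.sum_congr rfl fun σ _ => ?_
  split_ifs
  · exact one_smul ℂ _
  · exact zero_smul ℂ _

/-- **`J_r(n)` is Fourier-supported on partitions with at most `r` rows**: every `f` in the
colour cell has Fourier transform vanishing at each `[μ]` with `r < ℓ(μ)` (the generators by the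
class-sum computation, then linearity of `f ↦ f̂([μ])`). -/
theorem colourPricing_fourierSpecht_eq_zero {f : Equiv.Perm (Fin n) → ℂ}
    (hf : f ∈ Submodule.span ℂ {f : Equiv.Perm (Fin n) → ℂ | ∃ c c' : Fin n → Fin r,
        f = fun g : Equiv.Perm (Fin n) => if c' ∘ (⇑g) = c then (1 : ℂ) else 0})
    {μ : Nat.Partition n} (hμ : r < Multiset.card μ.parts) :
    fourierSpecht f μ = 0 := by
  induction hf using Submodule.span_induction with
  | mem f hf =>
    obtain ⟨c, c', rfl⟩ := hf
    apply LinearMap.ext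
    intro w
    apply Subtype.ext
    rw [EllisFriedgutPilpel2011.coe_fourierSpecht_apply, LinearMap.zero_apply, Submodule.coe_zero,
      colourPricing_sum_colourTest_smul_of,
      colourPricing_classSum_mul_eq_zero_of_mem_spechtIdeal c c' hμ w.2]
  | zero =>
    apply LinearMap.ext
    intro w
    simp [fourierSpecht]
  | add f g _ _ hf hg => rw [fourierSpecht_add, hf, hg, add_zero]
  | smul a f _ hf => rw [fourierSpecht_smul, hf, smul_zero]

/-- **Young's rule, pricing direction, for colourings**: if the Specht character `χ^μ` lies in the
colour cell `J_r(n)`, then `μ` has at most `r` rows (otherwise its Fourier transform at `[μ]`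
would vanish, contradicting `fourierSpecht_spechtCharacter_self_ne_zero`). -/
theorem colourPricing_card_parts_le {μ : Nat.Partition n}
    (hμ : spechtCharacter ℂ μ ∈ Submodule.span ℂ {f : Equiv.Perm (Fin n) → ℂ |
      ∃ c c' : Fin n → Fin r,
        f = fun g : Equiv.Perm (Fin n) => if c' ∘ (⇑g) = c then (1 : ℂ) else 0}) :
    Multiset.card μ.parts ≤ r := by
  by_contra hlt
  exact fourierSpecht_spechtCharacter_self_ne_zero μ
    (colourPricing_fourierSpecht_eq_zero hμ (not_le.1 hlt))

/-- **STUB A — Schur–Weyl pricing** (line `schur-weyl-colour-cells`, crux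
`LevelGradedCohnUmans.GradedDesignFamily`, item `stmt-MatrixMultiplication-7610`): for all `n r`
and every real `s`,
`∑ᶠ_{χ ∈ Irr(𝔖ₙ) ∩ J_r(n)} χ(1)^s ≤ ∑_{μ ⊢ n, ℓ(μ) ≤ r} (f^μ)^s` — every irreducible character in
the colour cell is a `χ^μ` with `ℓ(μ) ≤ r` (`colourPricing_card_parts_le`), distinct characters
have distinct `μ` (`spechtCharacter_injective`), `χ^μ(1) = f^μ` (`re_spechtCharacter_one`), and
the unused terms are `≥ 0`. -/
theorem stub_colourPricing (n r : ℕ) (s : ℝ) :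
    (∑ᶠ χ ∈ Literature.RepresentationTheory.FiniteGroups.irrChars (Equiv.Perm (Fin n)) ∩
        ((Submodule.span ℂ {f : Equiv.Perm (Fin n) → ℂ | ∃ c c' : Fin n → Fin r,
            f = fun g : Equiv.Perm (Fin n) => if c' ∘ (⇑g) = c then (1 : ℂ) else 0}) :
          Set (Equiv.Perm (Fin n) → ℂ)), (χ 1).re ^ s) ≤
      ∑ μ : Nat.Partition n, if Multiset.card μ.parts ≤ r then
        (Literature.NumberTheory.DiophantineGeometry.numStandardTableaux μ : ℝ) ^ s else 0 := by
  set J : Set (Equiv.Perm (Fin n) → ℂ) :=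
    ((Submodule.span ℂ {f : Equiv.Perm (Fin n) → ℂ | ∃ c c' : Fin n → Fin r,
        f = fun g : Equiv.Perm (Fin n) => if c' ∘ (⇑g) = c then (1 : ℂ) else 0}) :
      Set (Equiv.Perm (Fin n) → ℂ)) with hJ
  set T : Set (Nat.Partition n) := {μ | spechtCharacter ℂ μ ∈ J} with hT
  have hset : irrChars (Equiv.Perm (Fin n)) ∩ J =
      (fun μ : Nat.Partition n => spechtCharacter ℂ μ) '' T := by
    rw [irrChars_perm_eq]
    ext χ
    constructor
    · rintro ⟨⟨μ, rfl⟩, hχ⟩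
      exact ⟨μ, hχ, rfl⟩
    · rintro ⟨μ, hμ, rfl⟩
      exact ⟨⟨μ, rfl⟩, hμ⟩
  rw [hset, finsum_mem_image spechtCharacter_injective.injOn, finsum_mem_def,
    finsum_eq_sum_of_fintype]
  refine Finset.sum_le_sum fun μ _ => ?_
  by_cases hμ : μ ∈ T
  · rw [Set.indicator_of_mem hμ, if_pos (colourPricing_card_parts_le hμ), re_spechtCharacter_one]
  · rw [Set.indicator_of_notMem hμ]
    split_ifs
    · exact Real.rpow_nonneg (Nat.cast_nonneg _) _
    · exact le_rfl

end Summit.MatrixMultiplication.MatrixMultiplication.Theorems.GradedDesignFamily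

end
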